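import Summits.QuantumFields.BalabanUV.Beta.VertexToriSymmetryEnds

/-!
# Beta / VertexToriSymmetryCovariant — COVARIANT MATRIX FAMILIES `A(τ q) = U·A(q)·V`: the reflection ∕ permutation transports of
# `Beta/VertexToriSymmetry` discharged from TABLE COVARIANCE (β sub-cell, BINDER-OWNERS row CAP-k, lineage `b2b-balaban-beta-an5`,
# gen 22; node BETA-an5-g22-TORI-SYMMETRY part 3)

`Beta/VertexToriSymmetry(Ends)` reduce a vertex-tori certificate to a fundamental region given transports `P q → P (τ q)`, and discharge the
`conjNeg` and negation transports from `MatConjSymm` ∕ `MatNegTranspose`.  The remaining symmetries named by the CAP lane — single-coordinate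
reflections (CAP-KERNEL §4.15 (c): the `q₂, q₃` sign flips of the δ-axial SU(2) integrand; §4.8 (R) for the U(1) toy) and coordinate
permutations (§4.8 (P)) — act on the engines' MATRIX families by CONJUGATION: `A(τ q) = U·A(q)·V` with a constant pair `V·U = 1` (for a lattice
symmetry, `U` = the signed permutation of the bond ∕ internal index it induces and `V = U⁻¹ = Uᴴ`).  This module makes that structure kernel:

* §1 `MatCovariant τ U V A := ∀ q, A (τ q) = U * A q * V` and its closure under the one-loop algebra: constants with `U K V = K`, `add ∕ sub ∕
  neg ∕ smul` (by a `τ`-invariant scalar) `∕ sum`, `mul` (needs `V * U = 1`), the INVERSE (needs `V * U = 1`; then `U⁻¹ = V`, `V⁻¹ = U`),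
  the SHIFTED family `q ↦ A (q − p)` when `τ (q − p) = τ q − p` (reflections with `p_ν = 0`, permutations fixing `p`: `reflectAt_sub`,
  `permute_sub`); invariance of `trace` and `det`; the scalar one-loop forms `tr(A⁻¹B)`, `tr(A⁻¹ C A′⁻¹ D)` are `τ`-INVARIANT
  (`trace_resolvent_covariant`, `trace_bubble_covariant`) — the transport hypotheses `G (τ q) = G q` of `VertexToriSymmetryEnds` for these forms.
* §2 TABLE COVARIANCE ⟹ family covariance: for a frequency map `τ'` with `character x (τ q) = character (τ' x) q` (`character_reflectAt`:
  `τ' = reflectIdx ν`; `character_permute`: `τ' x = x ∘ σ⁻¹`), an offset set `S` mapped onto itself by `τ'`, and tables with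
  `K (τ'⁻¹ x) = U * K x * V` (reflections: `K (reflectIdx ν x) = U K x V`; permutations: `K (x ∘ σ) = U K x V`), the stencil family `q ↦ Σ_{x ∈ S} character x q • K x` is `MatCovariant τ U V` (`matCovariant_characterSum`, with the
  two instances `…_reflectAt`, `…_permute`).
* §3 the EUCLIDEAN OPERATOR NORM: `opNorm_unitary_mul` (`Uᴴ U = 1 ⟹ ‖U M‖₂ = ‖M‖₂`, by the C⋆-identity), `opNorm_mul_unitary`; hence for a
  covariant family with `Uᴴ U = 1`, `V Vᴴ = 1`, `V U = 1`: `‖A(τ q)‖ = ‖A(q)‖` and `‖A(τ q)⁻¹‖ = ‖A(q)⁻¹‖`; the TRANSPORT of route A's binder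
  `‖(A q)⁻¹‖ ≤ B` along `τ`, and the END `invNorm_le_vertexTori_of_plusRegion` (`hBa` on all vertex tori from the tori with `Im q_ν = +w_ν` for
  the covariantly reflected directions `ν ∈ V`).

HONEST FRAMING.  Kernel glue ([folklore] linear algebra): which reflections ∕ permutations are symmetries of the cell's actual tables, and with
which conjugators, is NOT asserted (hypotheses on typed tables nobody has typed); no number of the β-function, no certificate, no binder INSTANCE.
Discharging `BetaPertH` would make Bałaban's ultraviolet stability unconditional — NOT the continuum limit, NOT the Clay problem.  0 `sorry`,
0 cite tags.
-/

namespace Summit.QuantumFields.BalabanUV.Beta.VertexToriSymmetry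

open Complex Set Matrix
open Literature.MathematicalPhysics.QuantumFieldTheory.Balaban1983to89
open Summit.QuantumFields.BalabanUV.Beta.TubeMaximumModulus
open Summit.QuantumFields.BalabanUV.Beta.PolyRegularAlgebra (character)
open scoped Real ComplexConjugate Matrix.Norms.L2Operator

noncomputable section

variable {d : ℕ} {n : Type*} [Fintype n] [DecidableEq n]

/-! ## §1 Covariant matrix families and the one-loop algebra -/

section Covariant

/-- COVARIANCE of a matrix family under a map `τ` of momenta, with a constant conjugator pair `(U, V)`: `A (τ q) = U * A q * V`. [folklore] -/
def MatCovariant (τ : (Fin (d + 1) → ℂ) → (Fin (d + 1) → ℂ)) (U V : Matrix n n ℂ) (A : (Fin (d + 1) → ℂ) → Matrix n n ℂ) : Prop :=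
  ∀ q, A (τ q) = U * A q * V

variable {τ : (Fin (d + 1) → ℂ) → (Fin (d + 1) → ℂ)} {U V : Matrix n n ℂ} {A B C D : (Fin (d + 1) → ℂ) → Matrix n n ℂ}

omit [DecidableEq n] in
/-- a constant family commuting with the conjugation is covariant. [folklore] -/
theorem matCovariant_const {K : Matrix n n ℂ} (hK : U * K * V = K) : MatCovariant τ U V (fun _ => K) := fun _ => hK.symm

omit [DecidableEq n] in
/-- sums. [folklore] -/
theorem MatCovariant.add (hA : MatCovariant τ U V A) (hB : MatCovariant τ U V B) : MatCovariant τ U V (fun q => A q + B q) :=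
  fun q => by show A (τ q) + B (τ q) = U * (A q + B q) * V; rw [hA q, hB q, Matrix.mul_add, Matrix.add_mul]

omit [DecidableEq n] in
/-- negation. [folklore] -/
theorem MatCovariant.neg (hA : MatCovariant τ U V A) : MatCovariant τ U V (fun q => -A q) :=
  fun q => by show -A (τ q) = U * (-A q) * V; rw [hA q, Matrix.mul_neg, Matrix.neg_mul]

omit [DecidableEq n] in
/-- differences. [folklore] -/
theorem MatCovariant.sub (hA : MatCovariant τ U V A) (hB : MatCovariant τ U V B) : MatCovariant τ U V (fun q => A q - B q) :=
  fun q => by show A (τ q) - B (τ q) = U * (A q - B q) * V; rw [hA q, hB q, Matrix.mul_sub, Matrix.sub_mul]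

omit [DecidableEq n] in
/-- scalar multiples by a `τ`-INVARIANT scalar family. [folklore] -/
theorem MatCovariant.smul (hA : MatCovariant τ U V A) {g : (Fin (d + 1) → ℂ) → ℂ} (hg : ∀ q, g (τ q) = g q) :
    MatCovariant τ U V (fun q => g q • A q) :=
  fun q => by show g (τ q) • A (τ q) = U * (g q • A q) * V; rw [hA q, hg q, Matrix.mul_smul, Matrix.smul_mul]

omit [DecidableEq n] in
/-- finite sums. [folklore] -/
theorem MatCovariant.sum {ι : Type*} (s : Finset ι) {F : ι → (Fin (d + 1) → ℂ) → Matrix n n ℂ}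
    (h : ∀ i ∈ s, MatCovariant τ U V (F i)) : MatCovariant τ U V (fun q => ∑ i ∈ s, F i q) := by
  classical
  induction s using Finset.induction_on with
  | empty => intro q; simp
  | @insert i s hi ih =>
    have h' := (h i (Finset.mem_insert_self i s)).add (ih fun j hj => h j (Finset.mem_insert_of_mem hj))
    intro q
    simpa only [Finset.sum_insert hi] using h' q

/-- products (the conjugators cancel in the middle: `V * U = 1`). [folklore] -/
theorem MatCovariant.mul (hVU : V * U = 1) (hA : MatCovariant τ U V A) (hB : MatCovariant τ U V B) :
    MatCovariant τ U V (fun q => A q * B q) := fun q => by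
  show A (τ q) * B (τ q) = U * (A q * B q) * V
  rw [hA q, hB q]
  calc U * A q * V * (U * B q * V) = U * A q * (V * U) * B q * V := by simp only [Matrix.mul_assoc]
    _ = U * (A q * B q) * V := by rw [hVU, Matrix.mul_one, Matrix.mul_assoc U]

/-- THE INVERSE family is covariant (`(U A V)⁻¹ = V⁻¹ A⁻¹ U⁻¹ = U A⁻¹ V`). [folklore] -/
theorem MatCovariant.inv (hVU : V * U = 1) (hA : MatCovariant τ U V A) : MatCovariant τ U V (fun q => (A q)⁻¹) := fun q => by
  show (A (τ q))⁻¹ = U * (A q)⁻¹ * V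
  rw [hA q, Matrix.mul_inv_rev, Matrix.mul_inv_rev, Matrix.inv_eq_right_inv hVU, Matrix.inv_eq_left_inv hVU, Matrix.mul_assoc]

omit [DecidableEq n] in
/-- the SHIFTED family `q ↦ A (q − p)` is covariant whenever `τ (q − p) = τ q − p` (reflections with `p_ν = 0`, permutations fixing `p`). [folklore] -/
theorem MatCovariant.comp_sub (hA : MatCovariant τ U V A) {p : Fin (d + 1) → ℂ} (hτ : ∀ q, τ (q - p) = τ q - p) :
    MatCovariant τ U V (fun q => A (q - p)) := fun q => by
  show A (τ q - p) = U * A (q - p) * V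
  rw [← hτ q, hA (q - p)]

/-- the TRACE of a covariant family is `τ`-invariant. [folklore] -/
theorem MatCovariant.trace_eq (hVU : V * U = 1) (hA : MatCovariant τ U V A) (q : Fin (d + 1) → ℂ) :
    (A (τ q)).trace = (A q).trace := by
  rw [hA q, Matrix.trace_mul_cycle, hVU, Matrix.one_mul]

/-- the DETERMINANT of a covariant family is `τ`-invariant. [folklore] -/
theorem MatCovariant.det_eq (hVU : V * U = 1) (hA : MatCovariant τ U V A) (q : Fin (d + 1) → ℂ) :
    (A (τ q)).det = (A q).det := by
  rw [hA q, Matrix.det_mul, Matrix.det_mul]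
  have h := congrArg Matrix.det hVU
  rw [Matrix.det_mul, Matrix.det_one] at h
  calc U.det * (A q).det * V.det = (V.det * U.det) * (A q).det := by ring
    _ = (A q).det := by rw [h, one_mul]

/-- **THE TADPOLE TRACE IS INVARIANT**: `A, B` covariant ⟹ `tr(A(τq)⁻¹ B(τq)) = tr(A(q)⁻¹ B(q))`. [folklore] -/
theorem trace_resolvent_covariant (hVU : V * U = 1) (hA : MatCovariant τ U V A) (hB : MatCovariant τ U V B) (q : Fin (d + 1) → ℂ) :
    ((A (τ q))⁻¹ * B (τ q)).trace = ((A q)⁻¹ * B q).trace :=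
  MatCovariant.trace_eq hVU (MatCovariant.mul hVU (MatCovariant.inv hVU hA) hB) q

/-- **THE BUBBLE TRACE IS INVARIANT**: `A, C, A′, D` covariant (the shifted `A′` by `MatCovariant.comp_sub`) ⟹
`tr(A⁻¹ C A′⁻¹ D)(τq) = tr(A⁻¹ C A′⁻¹ D)(q)`. [folklore] -/
theorem trace_bubble_covariant {A' : (Fin (d + 1) → ℂ) → Matrix n n ℂ} (hVU : V * U = 1) (hA : MatCovariant τ U V A)
    (hC : MatCovariant τ U V C) (hA' : MatCovariant τ U V A') (hD : MatCovariant τ U V D) (q : Fin (d + 1) → ℂ) :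
    ((A (τ q))⁻¹ * C (τ q) * (A' (τ q))⁻¹ * D (τ q)).trace = ((A q)⁻¹ * C q * (A' q)⁻¹ * D q).trace :=
  MatCovariant.trace_eq hVU
    (MatCovariant.mul hVU (MatCovariant.mul hVU (MatCovariant.mul hVU (MatCovariant.inv hVU hA) hC)
      (MatCovariant.inv hVU hA')) hD) q

/-- hence the scalar ONE-LOOP FORM `t₁ − t₂` is `τ`-invariant — the transport hypothesis of `VertexToriSymmetryEnds.transport_norm_reflect` &c.
for this form. [folklore] -/
theorem oneLoopForm_covariant {A' : (Fin (d + 1) → ℂ) → Matrix n n ℂ} (hVU : V * U = 1) (hA : MatCovariant τ U V A)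
    (hA' : MatCovariant τ U V A') (hB : MatCovariant τ U V B) (hC : MatCovariant τ U V C) (hD : MatCovariant τ U V D)
    (q : Fin (d + 1) → ℂ) :
    ((A (τ q))⁻¹ * B (τ q)).trace - ((A (τ q))⁻¹ * C (τ q) * (A' (τ q))⁻¹ * D (τ q)).trace
      = ((A q)⁻¹ * B q).trace - ((A q)⁻¹ * C q * (A' q)⁻¹ * D q).trace := by
  rw [trace_resolvent_covariant hVU hA hB, trace_bubble_covariant hVU hA hC hA' hD]

end Covariant

/-! ## §2 Table covariance ⟹ family covariance -/

section Tables

/-- reflection of a FREQUENCY vector in direction `ν`. [folklore] -/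
def reflectIdx (ν : Fin (d + 1)) (x : Fin (d + 1) → ℤ) : Fin (d + 1) → ℤ := Function.update x ν (-x ν)

/-- the reflected entry. [folklore] -/
@[simp] theorem reflectIdx_apply_same (ν : Fin (d + 1)) (x : Fin (d + 1) → ℤ) : reflectIdx ν x ν = -x ν := by
  simp [reflectIdx]

/-- the other entries. [folklore] -/
@[simp] theorem reflectIdx_apply_ne {ν μ : Fin (d + 1)} (h : μ ≠ ν) (x : Fin (d + 1) → ℤ) : reflectIdx ν x μ = x μ := by
  simp [reflectIdx, Function.update_of_ne h]

/-- `reflectIdx ν` is an involution. [folklore] -/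
theorem reflectIdx_reflectIdx (ν : Fin (d + 1)) (x : Fin (d + 1) → ℤ) : reflectIdx ν (reflectIdx ν x) = x := by
  funext μ; by_cases h : μ = ν
  · subst h; simp
  · simp [h]

/-- a character at a reflected momentum is the character of the reflected frequency. [folklore] -/
theorem character_reflectAt (x : Fin (d + 1) → ℤ) (ν : Fin (d + 1)) (q : Fin (d + 1) → ℂ) :
    character x (reflectAt ν q) = character (reflectIdx ν x) q := by
  unfold character
  congr 2
  rw [Fin.sum_univ_succAbove _ ν, Fin.sum_univ_succAbove (fun μ => ((reflectIdx ν x μ : ℤ) : ℂ) * q μ) ν]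
  simp only [reflectAt_apply_same, reflectIdx_apply_same, Int.cast_neg, mul_neg, neg_mul]
  congr 1
  refine Finset.sum_congr rfl fun k _ => ?_
  rw [reflectAt_apply_ne (Fin.succAbove_ne ν k), reflectIdx_apply_ne (Fin.succAbove_ne ν k)]

/-- a character at a permuted momentum is the character of the inversely permuted frequency. [folklore] -/
theorem character_permute (x : Fin (d + 1) → ℤ) (σ : Equiv.Perm (Fin (d + 1))) (q : Fin (d + 1) → ℂ) :
    character x (permute σ q) = character (fun ν => x (σ.symm ν)) q := by
  unfold character
  congr 2
  simp only [permute_apply]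
  exact Fintype.sum_equiv σ _ _ fun μ => by simp

variable {τ : (Fin (d + 1) → ℂ) → (Fin (d + 1) → ℂ)} {U V : Matrix n n ℂ}

omit [DecidableEq n] in
/-- **TABLE COVARIANCE ⟹ FAMILY COVARIANCE.**  If the characters transform as `character x (τ q) = character (τ' x) q`, the offset set `S` is mapped
onto itself by `τ'` (with inverse `τ'inv` on `S`), and the tables satisfy `K (τ'inv x) = U * K x * V` on `S`, then the stencil family
`q ↦ Σ_{x ∈ S} character x q • K x` is `MatCovariant τ U V` (`A(τq) = Σ_x character (τ'x) q • K x = Σ_y character y q • K (τ'inv y)`). [folklore] -/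
theorem matCovariant_characterSum (τ' τ'inv : (Fin (d + 1) → ℤ) → (Fin (d + 1) → ℤ))
    (hchar : ∀ x q, character x (τ q) = character (τ' x) q)
    (S : Finset (Fin (d + 1) → ℤ)) (hS : ∀ x ∈ S, τ' x ∈ S) (hSinv : ∀ x ∈ S, τ'inv x ∈ S)
    (hleft : ∀ x ∈ S, τ'inv (τ' x) = x) (hright : ∀ x ∈ S, τ' (τ'inv x) = x)
    (K : (Fin (d + 1) → ℤ) → Matrix n n ℂ) (hK : ∀ x ∈ S, K (τ'inv x) = U * K x * V) :
    MatCovariant τ U V (fun q => ∑ x ∈ S, character x q • K x) := by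
  intro q
  simp only [hchar]
  rw [Finset.mul_sum, Finset.sum_mul]
  -- reindex the left sum by `x ↦ τ' x`
  refine Finset.sum_bij' (fun x _ => τ' x) (fun y _ => τ'inv y) hS hSinv hleft hright (fun x hx => ?_)
  rw [Matrix.mul_smul, Matrix.smul_mul, ← hK (τ' x) (hS x hx), hleft x hx]

omit [DecidableEq n] in
/-- instance: COORDINATE REFLECTION `q_ν ↦ −q_ν` with tables `K (reflectIdx ν x) = U * K x * V` over an offset set closed under `reflectIdx ν`. [folklore] -/
theorem matCovariant_characterSum_reflectAt (ν : Fin (d + 1)) (S : Finset (Fin (d + 1) → ℤ)) (hS : ∀ x ∈ S, reflectIdx ν x ∈ S)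
    (K : (Fin (d + 1) → ℤ) → Matrix n n ℂ) (hK : ∀ x ∈ S, K (reflectIdx ν x) = U * K x * V) :
    MatCovariant (reflectAt ν) U V (fun q => ∑ x ∈ S, character x q • K x) :=
  matCovariant_characterSum (reflectIdx ν) (reflectIdx ν) (fun x q => character_reflectAt x ν q) S hS hS
    (fun x _ => reflectIdx_reflectIdx ν x) (fun x _ => reflectIdx_reflectIdx ν x) K hK

omit [DecidableEq n] in
/-- instance: COORDINATE PERMUTATION `q ↦ q ∘ σ` with tables `K (x ∘ σ) = U * K x * V` over an offset set closed under `x ↦ x ∘ σ⁻¹` and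
`x ↦ x ∘ σ`. [folklore] -/
theorem matCovariant_characterSum_permute (σ : Equiv.Perm (Fin (d + 1))) (S : Finset (Fin (d + 1) → ℤ))
    (hS : ∀ x ∈ S, (fun ν => x (σ.symm ν)) ∈ S) (hSinv : ∀ x ∈ S, (fun ν => x (σ ν)) ∈ S)
    (K : (Fin (d + 1) → ℤ) → Matrix n n ℂ) (hK : ∀ x ∈ S, K (fun ν => x (σ ν)) = U * K x * V) :
    MatCovariant (permute σ) U V (fun q => ∑ x ∈ S, character x q • K x) :=
  matCovariant_characterSum (fun x ν => x (σ.symm ν)) (fun x ν => x (σ ν)) (fun x q => character_permute x σ q) S hS hSinv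
    (fun x _ => by funext ν; simp) (fun x _ => by funext ν; simp) K hK

/-- a reflection commutes with subtracting a momentum `p` with `p_ν = 0`: `reflectAt ν (q − p) = reflectAt ν q − p`. [folklore] -/
theorem reflectAt_sub {ν : Fin (d + 1)} {p : Fin (d + 1) → ℂ} (hp : p ν = 0) (q : Fin (d + 1) → ℂ) :
    reflectAt ν (q - p) = reflectAt ν q - p := by
  funext μ
  by_cases h : μ = ν
  · subst h; simp [hp]
  · simp [h]

/-- a permutation commutes with subtracting a momentum it fixes: `permute σ (q − p) = permute σ q − p`. [folklore] -/
theorem permute_sub {σ : Equiv.Perm (Fin (d + 1))} {p : Fin (d + 1) → ℂ} (hp : ∀ μ, p (σ μ) = p μ) (q : Fin (d + 1) → ℂ) :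
    permute σ (q - p) = permute σ q - p := by
  funext μ; simp [permute, hp μ]

end Tables

/-! ## §3 The Euclidean operator norm: unitary conjugators, transports and ENDs -/

section Norms

/-- **`Uᴴ U = 1 ⟹ ‖U M‖₂ = ‖M‖₂`** (C⋆-identity: `‖(UM)ᴴ(UM)‖ = ‖UM‖²` and `(UM)ᴴ(UM) = MᴴM`). [folklore] -/
theorem opNorm_unitary_mul {U : Matrix n n ℂ} (hU : star U * U = 1) (M : Matrix n n ℂ) : ‖U * M‖ = ‖M‖ := by
  have h1 : ‖star (U * M) * (U * M)‖ = ‖U * M‖ * ‖U * M‖ := CStarRing.norm_star_mul_self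
  have h2 : star (U * M) * (U * M) = star M * M := by
    rw [star_mul, Matrix.mul_assoc, ← Matrix.mul_assoc (star U), hU, Matrix.one_mul]
  have h3 : ‖star M * M‖ = ‖M‖ * ‖M‖ := CStarRing.norm_star_mul_self
  rw [h2, h3] at h1
  exact ((mul_self_inj (norm_nonneg _) (norm_nonneg _)).mp h1).symm

/-- **`V Vᴴ = 1 ⟹ ‖M V‖₂ = ‖M‖₂`**. [folklore] -/
theorem opNorm_mul_unitary {V : Matrix n n ℂ} (hV : V * star V = 1) (M : Matrix n n ℂ) : ‖M * V‖ = ‖M‖ := by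
  have e : M * V = star (star V * star M) := by rw [star_mul, star_star, star_star]
  have hV' : star (star V) * star V = 1 := by rw [star_star]; exact hV
  rw [e, norm_star, opNorm_unitary_mul hV', norm_star]

variable {τ : (Fin (d + 1) → ℂ) → (Fin (d + 1) → ℂ)} {U V : Matrix n n ℂ} {A : (Fin (d + 1) → ℂ) → Matrix n n ℂ}
  {w : Fin (d + 1) → ℝ}

/-- a covariant family with unitary-type conjugators has a `τ`-INVARIANT OPERATOR NORM. [folklore] -/
theorem MatCovariant.opNorm_eq (hA : MatCovariant τ U V A) (hU : star U * U = 1) (hV : V * star V = 1) (q : Fin (d + 1) → ℂ) :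
    ‖A (τ q)‖ = ‖A q‖ := by
  rw [hA q, opNorm_mul_unitary hV, opNorm_unitary_mul hU]

/-- … and a `τ`-INVARIANT RESOLVENT NORM. [folklore] -/
theorem MatCovariant.invNorm_eq (hA : MatCovariant τ U V A) (hVU : V * U = 1) (hU : star U * U = 1) (hV : V * star V = 1)
    (q : Fin (d + 1) → ℂ) : ‖(A (τ q))⁻¹‖ = ‖(A q)⁻¹‖ :=
  MatCovariant.opNorm_eq (MatCovariant.inv hVU hA) hU hV q

/-- for a UNITARY conjugator `U` (`Uᴴ U = 1`) with `V = Uᴴ`, the side condition `V Vᴴ = 1` holds. [folklore] -/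
theorem unitary_side {U : Matrix n n ℂ} (hU : star U * U = 1) : star U * star (star U) = 1 := by
  rw [star_star]; exact hU

/-- TRANSPORT of route A's binder along `τ` for a covariant family (unitary-type conjugators). [folklore] -/
theorem transport_invNorm_covariant (hA : MatCovariant τ U V A) (hVU : V * U = 1) (hU : star U * U = 1) (hV : V * star V = 1)
    {B : ℝ} : ∀ q ∈ VertexTori w, ‖(A q)⁻¹‖ ≤ B → ‖(A (τ q))⁻¹‖ ≤ B :=
  fun q _ h => by rw [MatCovariant.invNorm_eq hA hVU hU hV q]; exact h

/-- **END: route A's `hBa` on ALL vertex tori from the tori with `Im q_ν = +w_ν` for every covariantly reflected direction `ν ∈ V`**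
(each direction with its own unitary conjugator `U ν`, `V ν = (U ν)ᴴ`). [folklore] -/
theorem invNorm_le_vertexTori_of_plusRegion (Vs : Finset (Fin (d + 1))) (Uc : Fin (d + 1) → Matrix n n ℂ)
    (hU : ∀ ν ∈ Vs, star (Uc ν) * Uc ν = 1)
    (hA : ∀ ν ∈ Vs, MatCovariant (reflectAt ν) (Uc ν) (star (Uc ν)) A) {B : ℝ}
    (hreg : ∀ q ∈ VertexTori w, (∀ ν ∈ Vs, (q ν).im = w ν) → ‖(A q)⁻¹‖ ≤ B) :
    ∀ q ∈ VertexTori w, ‖(A q)⁻¹‖ ≤ B :=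
  of_plusRegion (P := fun q => ‖(A q)⁻¹‖ ≤ B) Vs
    (fun ν hν => transport_invNorm_covariant (hA ν hν) (hU ν hν) (hU ν hν) (unitary_side (hU ν hν)))
    hreg

/-- **END (scalar one-loop form): the transport hypothesis `G (reflectAt ν q) = G q` of `norm_le_vertexTori_of_plusTorus` DISCHARGED from
covariance** — with all five families covariant under `reflectAt ν` (conjugators with `V U = 1`) in every direction, a bound on the all-plus torus
is a bound on all vertex tori. [folklore] -/
theorem oneLoopForm_norm_le_vertexTori_of_plusTorus {A' B C D : (Fin (d + 1) → ℂ) → Matrix n n ℂ}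
    (Uc Vc : Fin (d + 1) → Matrix n n ℂ) (hVU : ∀ ν, Vc ν * Uc ν = 1)
    (hA : ∀ ν, MatCovariant (reflectAt ν) (Uc ν) (Vc ν) A) (hA' : ∀ ν, MatCovariant (reflectAt ν) (Uc ν) (Vc ν) A')
    (hB : ∀ ν, MatCovariant (reflectAt ν) (Uc ν) (Vc ν) B) (hC : ∀ ν, MatCovariant (reflectAt ν) (Uc ν) (Vc ν) C)
    (hD : ∀ ν, MatCovariant (reflectAt ν) (Uc ν) (Vc ν) D) {M : ℝ}
    (hM : ∀ p ∈ PlusTorus w, ‖((A p)⁻¹ * B p).trace - ((A p)⁻¹ * C p * (A' p)⁻¹ * D p).trace‖ ≤ M) :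
    ∀ p ∈ VertexTori w, ‖((A p)⁻¹ * B p).trace - ((A p)⁻¹ * C p * (A' p)⁻¹ * D p).trace‖ ≤ M :=
  norm_le_vertexTori_of_plusTorus
    (G := fun p => ((A p)⁻¹ * B p).trace - ((A p)⁻¹ * C p * (A' p)⁻¹ * D p).trace)
    (fun ν q _ => oneLoopForm_covariant (hVU ν) (hA ν) (hA' ν) (hB ν) (hC ν) (hD ν) q) hM

end Norms

end

end Summit.QuantumFields.BalabanUV.Beta.VertexToriSymmetry
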